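import Summits.CriticalPhenomena.SAWScalingLimit.Theorems.SAWLoopFugacityFlowIsingBoundaryRatioWindowCrossingMeet
import Literature.Probability.LatticeModels.MeshDomainJordan
import HarnessLib

/-!
# Radial crossings pass through the window rectangle — the chain of full cells along a chart semicircle
(line `fk-anchor-transfer`, crux `IsingBoundaryRatio`, stmt-CriticalPhenomena-10650; fourth helper module of the
proof of `AnnCrossThroughWindowRect`)

`windowBand_geometry`: the geometric input of the band-crossing lemma, with no reference to the rectangle `E`.
For the chordal chart `φ` of `(D; a, b)`, `M > 1`, `ε > 0` there is `ρ₀` such that for `ρ < ρ₀`, radii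
`ρ ≤ a₁ < a₂ < Mρ`, a margin `m > 0` and all small `δ`:
* (oscillation) the chart values of two mesh-adjacent sites of chart radius `≤ Mρ` differ by `< m`;
* (cells) there is a finite family `𝒬` of PERFECT cells with a distinguished cell `Q₀` such that: every corner of
  a cell of `𝒬` is a vertex of `Ω_δ` with mesh point in `B(a, ε)` and chart radius in `(a₁, a₂)`; the corners of
  `Q₀` have chart point in the cone `|re w| ≤ im w`; every family of cells containing `Q₀` and closed under
  "sharing a corner with a member, inside `𝒬`" contains `𝒬`; and every walk of `Ω_δ` from chart radius
  `≤ a₁` to chart radius `≥ a₂` through sites of chart radius `< Mρ` has a vertex at a corner of a cell of `𝒬`.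

Construction: `𝒬` = the perfect cells met by the initial pieces, inside `V = D ∖ ⋃ (closed non-perfect cells)`,
of the two quarter arcs of the chart circle `|w| = (a₁ + a₂)/2` from its top (`exists_quarterArc`,
`exists_descent`); `Q₀` = the cell of the top. Sharing-closedness is `forall_of_path_cover`; the corners of `Q₀`
are vertices of `Ω_δ` by `JordanDomain.eventually_forall_mem_meshDomain'`, the others by perfection along the
chain; the last clause is the crossing lemma `exists_dart_of_crosscut` for the cross-cut made of the two
descents (their tails avoid the mesh, and a lattice edge meeting a closed cell of the chain ends at a corner of
it, `exists_corner_of_mem_segment_of_mem_closure_cell`).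
-/

noncomputable section

open scoped Classical Topology
open Filter Set Metric SimpleGraph Complex
open Literature.Probability.LatticeModels Literature.Probability.RandomPlanarGeometry
open Literature.Probability.Percolation (BondConfig)
open Literature.Topology.PlaneTopology
open UpperHalfPlane (upperHalfPlaneSet)

namespace Summit.CriticalPhenomena.SAWScalingLimit.Theorems.IsingBoundaryRatio

set_option maxHeartbeats 4000000 in
/-- **The chain of full cells along a chart semicircle** (see the module docstring). [folklore] -/
theorem windowBand_geometry : ∀ (D : DobrushinDomain) (φ : ConformalEquiv upperHalfPlaneSet D.carrier), D.IsChordalUniformizing φ → ∀ (M : ℝ), 1 < M → ∀ (ε : ℝ), 0 < ε → ∃ ρ₀ : ℝ, 0 < ρ₀ ∧ ∀ (ρ : ℝ), 0 < ρ → ρ < ρ₀ → ∀ (a₁ a₂ m : ℝ), ρ ≤ a₁ → a₁ < a₂ → a₂ < M * ρ → 0 < m → (∀ z ∈ D.carrier, ‖φ.symm z‖ < M * ρ → z ∈ ball (D.pt 0) ε) ∧ ∀ᶠ δ in 𝓝[>] (0 : ℝ), (∀ x y : Site 2, (meshGraph D.carrier δ).Adj x y → meshPoint δ x ∈ D.carrier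 → meshPoint δ y ∈ D.carrier → ‖φ.symm (meshPoint δ x)‖ ≤ M * ρ → dist (φ.symm (meshPoint δ y)) (φ.symm (meshPoint δ x)) < m) ∧ ∃ (𝒬 : Finset (ℤ × ℤ)) (Q₀ : ℤ × ℤ), Q₀ ∈ 𝒬 ∧ (∀ Q ∈ 𝒬, Mesh.IsPerfect D.carrier δ Q.1 Q.2 ∧ ∀ a b : Bool, Mesh.corner Q.1 Q.2 a b ∈ meshDomain D.carrier δ ∧ meshPoint δ (Mesh.corner Q.1 Q.2 a b) ∈ ball (D.pt 0) ε ∧ a₁ < ‖φ.symm (meshPoint δ (Mesh.corner Q.1 Q.2 a b))‖ ∧ ‖φ.symm (meshPoint δ (Mesh.corner Q.1 Q.2 a b))‖ < a₂) ∧ (∀ a b : Bool, |(φ.symm (meshPoint δ (Mesh.corner Q₀.1 Q₀.2 a b))).re| ≤ (φ.symm (meshPoint δ (Mesh.corner Q₀.1 Q₀.2 a b))).im) ∧ (∀ S : Set (ℤ × ℤ), Q₀ ∈ S → (∀ Q ∈ 𝒬, Q ∈ S → ∀ Q' ∈ 𝒬, (∃ a b a' b' : Bool, Mesh.corner Q.1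 Q.2 a b = Mesh.corner Q'.1 Q'.2 a' b') → Q' ∈ S) → ∀ Q ∈ 𝒬, Q ∈ S) ∧ (∀ (u v : Site 2) (W : (discreteDomainGraph D.carrier δ).Walk u v), ‖φ.symm (meshPoint δ u)‖ ≤ a₁ → a₂ ≤ ‖φ.symm (meshPoint δ v)‖ → (∀ e ∈ W.darts, ‖φ.symm (meshPoint δ e.fst)‖ < M * ρ) → ∃ Q ∈ 𝒬, ∃ z ∈ W.support, ∃ a b : Bool, z = Mesh.corner Q.1 Q.2 a b) := by
  intro D φ hφ M hM ε hε
  have hM0 : 0 < M := one_pos.trans hM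
  obtain ⟨rb, hrb, hball⟩ := Metric.tendsto_nhdsWithin_nhds.1 hφ.1 ε hε
  refine ⟨rb / M, div_pos hrb hM0, fun ρ hρ hρr a₁ a₂ m ha₁ ha₁₂ ha₂ hm => ?_⟩
  have hMr : M * ρ < rb := by rwa [lt_div_iff₀ hM0, mul_comm] at hρr
  have hinball : ∀ z ∈ D.carrier, ‖φ.symm z‖ < M * ρ → z ∈ ball (D.pt 0) ε := by
    intro z hz hzr
    have h := hball (φ.symm_mapsTo hz) (by rw [dist_zero_right]; exact hzr.trans hMr)
    rwa [φ.apply_symm_apply hz] at h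
  refine ⟨hinball, ?_⟩
  obtain ⟨g, f, d, hd, hgc, hgeq, hgreal, hginj, -, hfar, hfc, hfpos, hdisk, hfreal⟩ :=
    exists_chart_pair hφ (M * ρ)
  -- the compact set `B` on which `g` is uniformly continuous
  set B : Set ℂ := closure D.carrier ∩ (ball (D.pt 1) (d / 2))ᶜ with hB
  have hBc : IsCompact B := D.isBounded.isCompact_closure.inter_right isOpen_ball.isClosed_compl
  have hBsub : B ⊆ closure D.carrier \ {D.pt 1} := by
    rintro z ⟨hz, hzb⟩
    refine ⟨hz, fun h => hzb ?_⟩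
    rw [mem_singleton_iff] at h
    rw [h]; exact Metric.mem_ball_self (half_pos hd)
  have hgB : ContinuousOn g B := hgc.mono hBsub
  have hginjB : InjOn g B := hginj.mono hBsub
  have hmemB : ∀ z ∈ closure D.carrier, d / 2 ≤ dist z (D.pt 1) → z ∈ B := fun z hz hzd =>
    ⟨hz, fun h => by rw [Metric.mem_ball] at h; linarith⟩
  have hgim : ∀ z ∈ B, 0 ≤ (g z).im := by
    intro z hz
    have hz' := hBsub hz
    rw [closure_eq_self_union_frontier] at hz'
    rcases hz'.1 with h | h
    · rw [hgeq h]; exact le_of_lt (φ.symm_mapsTo h)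
    · exact (hgreal z h hz'.2).ge
  -- radius and margins
  set r : ℝ := (a₁ + a₂) / 2 with hr
  have hr0 : 0 < r := by rw [hr]; linarith
  have hrR : r ≤ M * ρ := by rw [hr]; linarith
  set m' : ℝ := min (min m ((a₂ - a₁) / 2)) (r / 2) with hm'
  have hm'0 : 0 < m' := lt_min (lt_min hm (by linarith)) (by linarith)
  have hm'm : m' ≤ m := (min_le_left _ _).trans (min_le_left _ _)
  have hm'a : m' ≤ (a₂ - a₁) / 2 := (min_le_left _ _).trans (min_le_right _ _)
  have hm'r : m' ≤ r / 2 := min_le_right _ _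
  obtain ⟨η, hη, hηg⟩ := Metric.uniformContinuousOn_iff.1 (hBc.uniformContinuousOn_of_continuous hgB) m' hm'0
  -- the top point and a compact neighbourhood of it
  have hrI : 0 < ((r : ℂ) * I).im := by simp [hr0]
  have hrIn : ‖(r : ℂ) * I‖ ≤ M * ρ := by
    rw [norm_mul, norm_I, mul_one, norm_real, Real.norm_eq_abs, abs_of_pos hr0]; exact hrR
  obtain ⟨-, hztopD⟩ := hfpos _ hrI
  set ztop : ℂ := f (r * I) with hztop
  obtain ⟨sD, hsD, hsDball⟩ := Metric.isOpen_iff.1 D.isOpen ztop hztopD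
  have hKD : closedBall ztop (sD / 2) ⊆ D.carrier :=
    (closedBall_subset_ball (half_lt_self hsD)).trans hsDball
  have hK := JordanDomain.eventually_forall_mem_meshDomain' D.toJordanDomain
    (isCompact_closedBall ztop (sD / 2)) hKD
  have hδ₀ : 0 < min (η / 7) (min (d / 14) (sD / 8)) := by positivity
  filter_upwards [Ioo_mem_nhdsGT hδ₀, hK] with δ hδ hKδ
  obtain ⟨hδ0, hδlt⟩ := hδ
  have h6 : 6 * δ < η := by linarith [(lt_min_iff.1 hδlt).1]
  have h7 : 7 * δ ≤ d / 2 := by linarith [(lt_min_iff.1 (lt_min_iff.1 hδlt).2).1]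
  have h8 : 4 * δ ≤ sD / 2 := by linarith [(lt_min_iff.1 (lt_min_iff.1 hδlt).2).2]
  -- the chart oscillation over one mesh edge
  have hcontc : ∀ x y : Site 2, (meshGraph D.carrier δ).Adj x y → meshPoint δ x ∈ D.carrier →
      meshPoint δ y ∈ D.carrier → ‖φ.symm (meshPoint δ x)‖ ≤ M * ρ →
      dist (φ.symm (meshPoint δ y)) (φ.symm (meshPoint δ x)) < m := by
    intro x y hxy hxD hyD hxR
    have hzd := (meshGraph_adj_iff.1 hxy).1
    have hdxy : dist (meshPoint δ x) (meshPoint δ y) = δ := by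
      have := Literature.Probability.Percolation.dist_meshPoint_of_adj (δ := δ) hzd
      rwa [abs_of_pos hδ0] at this
    have hxb := hfar _ hxD hxR
    have hxB : meshPoint δ x ∈ B := hmemB _ (subset_closure hxD) (by linarith)
    have hyB : meshPoint δ y ∈ B := hmemB _ (subset_closure hyD)
      (by linarith [dist_triangle (meshPoint δ x) (meshPoint δ y) (D.pt 1)])
    have := hηg _ hyB _ hxB (by rw [_root_.dist_comm, hdxy]; linarith)
    rw [hgeq hyD, hgeq hxD] at this
    exact this.trans_le hm'm
  refine ⟨hcontc, ?_⟩
  -- the two quarter arcs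
  obtain ⟨qm, cm, hqm, hcm⟩ := exists_quarterArc (σ := 1) hfc hdisk hfreal hr0 hrR (Or.inl rfl)
  obtain ⟨qp, cp, hqp, hcp⟩ := exists_quarterArc (σ := -1) hfc hdisk hfreal hr0 hrR (Or.inr rfl)
  have hqmD : qm ∉ D.carrier := fun h => by rw [IsOpen.frontier_eq D.isOpen] at hqm; exact hqm.2 h
  have hqpD : qp ∉ D.carrier := fun h => by rw [IsOpen.frontier_eq D.isOpen] at hqp; exact hqp.2 h
  -- cells: the box, the non-perfect cells `I₀`, the perfect cells `𝒞`, the open set `V`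
  obtain ⟨Rb, hRb⟩ := D.isBounded.subset_closedBall (0 : ℂ)
  set box : Finset (ℤ × ℤ) := Finset.Icc (-⌈Rb / δ⌉) ⌈Rb / δ⌉ ×ˢ Finset.Icc (-⌈Rb / δ⌉) ⌈Rb / δ⌉
    with hbox
  set I₀ : Finset (ℤ × ℤ) := box.filter (fun q => ¬ Mesh.IsPerfect D.carrier δ q.1 q.2) with hI₀
  have hI₀np : ∀ q ∈ I₀, ¬ Mesh.IsPerfect D.carrier δ q.1 q.2 := fun q hq => (Finset.mem_filter.1 hq).2
  set 𝒞 : Finset (ℤ × ℤ) := box.filter (fun q => Mesh.IsPerfect D.carrier δ q.1 q.2) with h𝒞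
  have h𝒞mem : ∀ k j, Mesh.IsPerfect D.carrier δ k j → (k, j) ∈ 𝒞 := fun k j h =>
    Finset.mem_filter.2 ⟨mem_box_of_isPerfect hδ0 hRb h, h⟩
  set V : Set ℂ := D.carrier \ ⋃ q ∈ I₀, closure (Mesh.cell δ q.1 q.2) with hV
  set F : Set ℂ := ⋃ q ∈ 𝒞, closure (Mesh.cell δ q.1 q.2) with hF
  have hFc : IsClosed F := isClosed_biUnion_finset fun q _ => isClosed_closure
  have hfloor_box : ∀ z ∈ D.carrier, (⌊z.re / δ⌋, ⌊z.im / δ⌋) ∈ box := by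
    intro z hz
    have hzR : ‖z‖ ≤ Rb := by have := hRb hz; rwa [mem_closedBall, dist_zero_right] at this
    have key : ∀ a : ℝ, |a| ≤ Rb → ⌊a / δ⌋ ∈ Finset.Icc (-⌈Rb / δ⌉) ⌈Rb / δ⌉ := fun a ha => by
      obtain ⟨h1, h2⟩ := abs_le.1 ha
      rw [Finset.mem_Icc]
      constructor
      · rw [Int.le_floor]
        push_cast
        rw [le_div_iff₀ hδ0]
        have := Int.le_ceil (Rb / δ)
        rw [div_le_iff₀ hδ0] at this
        linarith
      · have h3 : (⌊a / δ⌋ : ℝ) ≤ ⌈Rb / δ⌉ :=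
          (Int.floor_le _).trans ((div_le_div_of_nonneg_right h2 hδ0.le).trans (Int.le_ceil _))
        exact_mod_cast h3
    exact Finset.mem_product.2 ⟨key _ ((abs_re_le_norm z).trans hzR), key _ ((abs_im_le_norm z).trans hzR)⟩
  have hVF : V ⊆ F := by
    intro z hz
    have hzc := wer_mem_closure_cell_floor hδ0 z
    have hq : (⌊z.re / δ⌋, ⌊z.im / δ⌋) ∈ 𝒞 := by
      refine Finset.mem_filter.2 ⟨hfloor_box z hz.1, ?_⟩
      by_contra hnp
      exact hz.2 (mem_iUnion₂.2 ⟨(⌊z.re / δ⌋, ⌊z.im / δ⌋),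
        Finset.mem_filter.2 ⟨hfloor_box z hz.1, hnp⟩, hzc⟩)
    exact mem_iUnion₂.2 ⟨_, hq, hzc⟩
  have hclVF : closure V ⊆ F := closure_minimal hVF hFc
  -- cells near the top point are perfect, with corners in the compact neighbourhood
  have hperf_near : ∀ k j : ℤ, (∃ z ∈ closure (Mesh.cell δ k j), dist z ztop ≤ 2 * δ) →
      Mesh.IsPerfect D.carrier δ k j ∧
        ∀ a b, meshPoint δ (Mesh.corner k j a b) ∈ closedBall ztop (sD / 2) := by
    rintro k j ⟨z, hz, hzd⟩
    have hsub : closure (Mesh.cell δ k j) ⊆ closedBall ztop (sD / 2) := fun y hy => by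
      rw [mem_closedBall]
      linarith [dist_le_of_mem_closure_cell hδ0 hy hz, dist_triangle y z ztop]
    exact ⟨isPerfect_of_closure_cell_subset hδ0 (hsub.trans hKD), fun a b =>
      hsub (Mesh.meshPoint_corner_mem_closure_cell hδ0 k j a b)⟩
  have hztopV : ztop ∈ V := by
    refine ⟨hztopD, fun h => ?_⟩
    obtain ⟨q, hq, hzq⟩ := mem_iUnion₂.1 h
    exact hI₀np q hq (hperf_near q.1 q.2 ⟨ztop, hzq, by rw [_root_.dist_self]; positivity⟩).1
  -- the two descents
  obtain ⟨pm, Qm, qm', Γm, hQmc, hpm, hQmV, hqm', hqm'd, hΓmD, hΓm⟩ :=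
    exists_descent D.toJordanDomain hδ0 I₀ hI₀np cm hztopV hqmD (fun y hy => (hcm y hy).1)
  obtain ⟨pp, Qp, qp', Γp, hQpc, hpp, hQpV, hqp', hqp'd, hΓpD, hΓp⟩ :=
    exists_descent D.toJordanDomain hδ0 I₀ hI₀np cp hztopV hqpD (fun y hy => (hcp y hy).1)
  have hQm_prop : ∀ y ∈ range Qm, y ∈ B ∧ ‖g y‖ = r ∧ 1 * (g y).re ≤ 0 ∧ d ≤ dist y (D.pt 1) :=
    fun y hy => by
    obtain ⟨h1, h2, h3, h4, -⟩ := hcm y (hQmc hy)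
    exact ⟨hmemB y h1 (by linarith), h3, h4, h2⟩
  have hQp_prop : ∀ y ∈ range Qp, y ∈ B ∧ ‖g y‖ = r ∧ (-1) * (g y).re ≤ 0 ∧ d ≤ dist y (D.pt 1) :=
    fun y hy => by
    obtain ⟨h1, h2, h3, h4, -⟩ := hcp y (hQpc hy)
    exact ⟨hmemB y h1 (by linarith), h3, h4, h2⟩
  have hpmQ : pm ∈ range Qm := ⟨1, Qm.target⟩
  have hppQ : pp ∈ range Qp := ⟨1, Qp.target⟩
  have hQmF : range Qm ⊆ F := by
    rintro y ⟨t, rfl⟩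
    rcases hQmV t with h | h
    · exact hVF h
    · rw [h]; exact hclVF (frontier_subset_closure hpm)
  have hQpF : range Qp ⊆ F := by
    rintro y ⟨t, rfl⟩
    rcases hQpV t with h | h
    · exact hVF h
    · rw [h]; exact hclVF (frontier_subset_closure hpp)
  -- the chain `𝒬` of perfect cells met by the two initial pieces, and the top cell `Q₀`
  set L₀ : Path pp pm := Qp.symm.trans Qm with hL₀
  have hL₀r : range L₀ = range Qp ∪ range Qm := by rw [hL₀, Path.trans_range, Path.symm_range]
  have hL₀F : range L₀ ⊆ F := by rw [hL₀r]; exact union_subset hQpF hQmF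
  have hL₀B : ∀ y ∈ range L₀, y ∈ B ∧ ‖g y‖ = r ∧ d ≤ dist y (D.pt 1) := by
    intro y hy
    rw [hL₀r] at hy
    rcases hy with hy | hy
    · exact ⟨(hQp_prop y hy).1, (hQp_prop y hy).2.1, (hQp_prop y hy).2.2.2⟩
    · exact ⟨(hQm_prop y hy).1, (hQm_prop y hy).2.1, (hQm_prop y hy).2.2.2⟩
  set 𝒬 : Finset (ℤ × ℤ) := 𝒞.filter (fun q => (closure (Mesh.cell δ q.1 q.2) ∩ range L₀).Nonempty) with h𝒬
  set Q₀ : ℤ × ℤ := (⌊ztop.re / δ⌋, ⌊ztop.im / δ⌋) with hQ₀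
  have hztopQ₀ : ztop ∈ closure (Mesh.cell δ Q₀.1 Q₀.2) := wer_mem_closure_cell_floor hδ0 ztop
  have hQ₀perf := hperf_near Q₀.1 Q₀.2 ⟨ztop, hztopQ₀, by rw [_root_.dist_self]; positivity⟩
  have hztopL₀ : ztop ∈ range L₀ := by rw [hL₀r]; exact Or.inr ⟨0, Qm.source⟩
  have hQ₀𝒞 : Q₀ ∈ 𝒞 := h𝒞mem _ _ hQ₀perf.1
  have hQ₀𝒬 : Q₀ ∈ 𝒬 := Finset.mem_filter.2 ⟨hQ₀𝒞, ztop, hztopQ₀, hztopL₀⟩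
  -- sharing-closedness along the chain
  have hconn : ∀ S : Set (ℤ × ℤ), Q₀ ∈ S →
      (∀ Q ∈ 𝒬, Q ∈ S → ∀ Q' ∈ 𝒬,
        (∃ a b a' b' : Bool, Mesh.corner Q.1 Q.2 a b = Mesh.corner Q'.1 Q'.2 a' b') → Q' ∈ S) →
      ∀ Q ∈ 𝒬, Q ∈ S := by
    intro S hS0 hstep Q hQ
    obtain ⟨hQ𝒞, hQne⟩ := Finset.mem_filter.1 hQ
    refine forall_of_path_cover L₀ 𝒞 (fun q => closure (Mesh.cell δ q.1 q.2)) (fun _ _ => isClosed_closure)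
      (fun y hy => hL₀F hy) S ⟨Q₀, hQ₀𝒞, hS0, ztop, hztopQ₀, hztopL₀⟩ ?_ Q hQ𝒞 hQne
    rintro i hi hiS i' hi' ⟨z, ⟨hzi, hzi'⟩, hzL⟩
    exact hstep i (Finset.mem_filter.2 ⟨hi, z, hzi, hzL⟩) hiS i' (Finset.mem_filter.2 ⟨hi', z, hzi', hzL⟩)
      (exists_corner_eq_of_mem_closure_cell hδ0 hzi hzi')
  -- corners of the cells of the chain
  have hcorner : ∀ Q ∈ 𝒬, Mesh.IsPerfect D.carrier δ Q.1 Q.2 ∧ ∀ a b : Bool,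
      meshPoint δ (Mesh.corner Q.1 Q.2 a b) ∈ D.carrier ∧
      r - m' < ‖φ.symm (meshPoint δ (Mesh.corner Q.1 Q.2 a b))‖ ∧
      ‖φ.symm (meshPoint δ (Mesh.corner Q.1 Q.2 a b))‖ < r + m' := by
    intro Q hQ
    obtain ⟨hQ𝒞, y, hyQ, hyL⟩ := Finset.mem_filter.1 hQ
    have hperf : Mesh.IsPerfect D.carrier δ Q.1 Q.2 := (Finset.mem_filter.1 hQ𝒞).2
    refine ⟨hperf, fun a b => ?_⟩
    have hκD : meshPoint δ (Mesh.corner Q.1 Q.2 a b) ∈ D.carrier := hperf.2 a b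
    have hκc := Mesh.meshPoint_corner_mem_closure_cell hδ0 Q.1 Q.2 a b
    have hdκy : dist (meshPoint δ (Mesh.corner Q.1 Q.2 a b)) y ≤ 2 * δ :=
      dist_le_of_mem_closure_cell hδ0 hκc hyQ
    obtain ⟨hyB, hyr, hyd⟩ := hL₀B y hyL
    have hκB : meshPoint δ (Mesh.corner Q.1 Q.2 a b) ∈ B := hmemB _ (subset_closure hκD)
      (by linarith [dist_triangle y (meshPoint δ (Mesh.corner Q.1 Q.2 a b)) (D.pt 1),
        _root_.dist_comm y (meshPoint δ (Mesh.corner Q.1 Q.2 a b))])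
    have hg := hηg _ hκB _ hyB (by linarith)
    rw [hgeq hκD, dist_eq_norm] at hg
    refine ⟨hκD, ?_, ?_⟩
    · have := norm_sub_norm_le (g y) (φ.symm (meshPoint δ (Mesh.corner Q.1 Q.2 a b)))
      rw [norm_sub_rev] at this
      linarith
    · have := norm_sub_norm_le (φ.symm (meshPoint δ (Mesh.corner Q.1 Q.2 a b))) (g y)
      linarith
  -- corners are vertices of `Ω_δ`: from the top cell along the chain
  have hmd : ∀ Q ∈ 𝒬, ∀ a b : Bool, Mesh.corner Q.1 Q.2 a b ∈ meshDomain D.carrier δ := by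
    refine hconn {Q | ∀ a b : Bool, Mesh.corner Q.1 Q.2 a b ∈ meshDomain D.carrier δ} ?_ ?_
    · intro a b
      exact hKδ.1 _ (hQ₀perf.2 a b)
    · rintro Q - hQS Q' hQ' ⟨a, b, a', b', hab⟩
      have hperf' : Mesh.IsPerfect D.carrier δ Q'.1 Q'.2 := (hcorner Q' hQ').1
      have hκ : Mesh.corner Q'.1 Q'.2 a' b' ∈ meshDomain D.carrier δ := hab ▸ hQS a b
      intro a'' b''
      have h1 := Mesh.reachable_corner_of_isPerfect hδ0 hperf' a' b'
      have h2 := Mesh.reachable_corner_of_isPerfect hδ0 hperf' a'' b''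
      exact mem_meshDomain_of_reachable_meshVertexGraph hκ (hperf'.2 a' b') (hperf'.2 a'' b'')
        (h1.symm.trans h2)
  -- the top cell lies in the cone
  have hcone : ∀ a b : Bool, |(φ.symm (meshPoint δ (Mesh.corner Q₀.1 Q₀.2 a b))).re| ≤
      (φ.symm (meshPoint δ (Mesh.corner Q₀.1 Q₀.2 a b))).im := by
    intro a b
    have hκD : meshPoint δ (Mesh.corner Q₀.1 Q₀.2 a b) ∈ D.carrier := hQ₀perf.1.2 a b
    have hκc := Mesh.meshPoint_corner_mem_closure_cell hδ0 Q₀.1 Q₀.2 a b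
    have hdκ : dist (meshPoint δ (Mesh.corner Q₀.1 Q₀.2 a b)) ztop ≤ 2 * δ :=
      dist_le_of_mem_closure_cell hδ0 hκc hztopQ₀
    obtain ⟨hzcl, hzd, hgz⟩ := hdisk (r * I) hrI.le hrIn
    have hzB : ztop ∈ B := hmemB _ hzcl (by linarith)
    have hκB : meshPoint δ (Mesh.corner Q₀.1 Q₀.2 a b) ∈ B := hmemB _ (subset_closure hκD)
      (by linarith [dist_triangle ztop (meshPoint δ (Mesh.corner Q₀.1 Q₀.2 a b)) (D.pt 1),
        _root_.dist_comm ztop (meshPoint δ (Mesh.corner Q₀.1 Q₀.2 a b))])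
    have hg := hηg _ hκB _ hzB (by linarith)
    rw [hgeq hκD, hztop, hgz, dist_eq_norm] at hg
    have hre := abs_re_le_norm (φ.symm (meshPoint δ (Mesh.corner Q₀.1 Q₀.2 a b)) - r * I)
    have him := abs_im_le_norm (φ.symm (meshPoint δ (Mesh.corner Q₀.1 Q₀.2 a b)) - r * I)
    simp only [sub_re, mul_re, ofReal_re, I_re, mul_zero, ofReal_im, I_im, mul_one, sub_self, sub_zero,
      sub_im, mul_im] at hre him
    have him' := (abs_lt.1 (him.trans_lt hg)).1
    refine (hre.trans hg.le).trans ?_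
    linarith
  refine ⟨𝒬, Q₀, hQ₀𝒬, fun Q hQ => ⟨(hcorner Q hQ).1, fun a b => ?_⟩, hcone, hconn, ?_⟩
  · obtain ⟨hκD, h1, h2⟩ := (hcorner Q hQ).2 a b
    exact ⟨hmd Q hQ a b, hinball _ hκD (by linarith), by rw [hr] at h1; linarith,
      by rw [hr] at h2; linarith⟩
  -- the crossing clause
  intro u v W hu hv hW
  set L : Path qp' qm' := Γp.symm.trans Γm with hL
  have hLr : range L = range Γp ∪ range Γm := by rw [hL, Path.trans_range, Path.symm_range]
  have hΓprop : ∀ (p₁ : ℂ) {q₁ : ℂ} (Q₁ : Path ztop p₁) (Γ₁ : Path ztop q₁),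
      (∀ y ∈ range Q₁, y ∈ B ∧ ‖g y‖ = r) → p₁ ∈ range Q₁ → d ≤ dist p₁ (D.pt 1) →
      (∀ t, Γ₁ t ∈ D.carrier ∨ Γ₁ t = q₁) → q₁ ∈ frontier D.carrier →
      (∀ y ∈ range Γ₁, y ∈ range Q₁ ∨ (Mesh.AvoidsMesh D.carrier δ y ∧ dist y p₁ < 6 * δ)) →
      ∀ y ∈ range Γ₁, y ∈ B ∧ r - m' ≤ ‖g y‖ ∧ ‖g y‖ ≤ r + m' := by
    intro p₁ q₁ Q₁ Γ₁ hQ₁ hp₁ hp₁d hΓ₁D hq₁ hΓ₁ y hy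
    rcases hΓ₁ y hy with h | ⟨-, hyp⟩
    · obtain ⟨hyB, hyr⟩ := hQ₁ y h
      exact ⟨hyB, by rw [hyr]; linarith, by rw [hyr]; linarith⟩
    · have hycl : y ∈ closure D.carrier := by
        obtain ⟨t, rfl⟩ := hy
        rcases hΓ₁D t with h' | h'
        · exact subset_closure h'
        · rw [h']; exact frontier_subset_closure hq₁
      obtain ⟨hp₁B, hp₁r⟩ := hQ₁ p₁ hp₁
      have hyB : y ∈ B := hmemB y hycl
        (by linarith [dist_triangle p₁ y (D.pt 1), _root_.dist_comm y p₁])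
      have hg := hηg y hyB p₁ hp₁B (by linarith)
      rw [dist_eq_norm] at hg
      refine ⟨hyB, ?_, ?_⟩
      · have := norm_sub_norm_le (g p₁) (g y); rw [norm_sub_rev] at this; linarith
      · have := norm_sub_norm_le (g y) (g p₁); linarith
  have hΓm' := hΓprop pm Qm Γm (fun y hy => ⟨(hQm_prop y hy).1, (hQm_prop y hy).2.1⟩) hpmQ
    (hQm_prop pm hpmQ).2.2.2 hΓmD hqm' hΓm
  have hΓp' := hΓprop pp Qp Γp (fun y hy => ⟨(hQp_prop y hy).1, (hQp_prop y hy).2.1⟩) hppQ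
    (hQp_prop pp hppQ).2.2.2 hΓpD hqp' hΓp
  have hLpts : ∀ t, L t ∈ B ∧ r - m' ≤ ‖g (L t)‖ ∧ ‖g (L t)‖ ≤ r + m' := fun t => by
    have : L t ∈ range L := mem_range_self t
    rw [hLr] at this
    rcases this with h | h
    exacts [hΓp' _ h, hΓm' _ h]
  -- the feet of the cross-cut
  have hfoot : ∀ (σ : ℝ) (p₁ q₁ : ℂ), (σ = 1 ∨ σ = -1) → q₁ ∈ frontier D.carrier → q₁ ∈ B →
      dist q₁ p₁ < 6 * δ → p₁ ∈ B → ‖g p₁‖ = r → σ * (g p₁).re ≤ 0 →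
      σ * (g q₁).re < 0 ∧ (g q₁).im = 0 := by
    intro σ p₁ q₁ hσ hq₁ hq₁B hd₁ hp₁B hp₁r hp₁re
    have him : (g q₁).im = 0 := hgreal q₁ hq₁ (hBsub hq₁B).2
    have hg := hηg q₁ hq₁B p₁ hp₁B (by linarith)
    exact ⟨mul_re_neg_of_dist_lt (by linarith) hp₁r hσ hp₁re him hg, him⟩
  obtain ⟨hpmB, hpmr, hpmre, -⟩ := hQm_prop pm hpmQ
  obtain ⟨hppB, hppr, hppre, -⟩ := hQp_prop pp hppQ
  obtain ⟨hm1, hm2⟩ := hfoot 1 pm qm' (Or.inl rfl) hqm' (hΓm' qm' ⟨1, Γm.target⟩).1 hqm'd hpmB hpmr hpmre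
  obtain ⟨hp1, hp2⟩ :=
    hfoot (-1) pp qp' (Or.inr rfl) hqp' (hΓp' qp' ⟨1, Γp.target⟩).1 hqp'd hppB hppr hppre
  have hargm : arg (g qm') = Real.pi := arg_eq_pi_iff.2 ⟨by linarith, hm2⟩
  have hargp : arg (g qp') = 0 := arg_eq_zero_iff.2 ⟨by linarith, hp2⟩
  -- the crossing lemma
  have ha₁r : a₁ ≤ r - m' := by rw [hr]; linarith
  have ha₂r : r + m' ≤ a₂ := by rw [hr]; linarith
  obtain ⟨y, hyL, e, he, hye⟩ := exists_dart_of_crosscut hBc hgB hginjB hgeq hgim hmemB hfar hδ0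
    (by linarith) hm'0 (by linarith) L hLpts hargp hargm W (hu.trans ha₁r) (ha₂r.trans hv)
    (fun e he => (hW e he).le)
  have hdart := discreteDomainGraph_adj_iff.1 e.adj
  have havoid : ¬ Mesh.AvoidsMesh D.carrier δ y := fun h =>
    h.2 _ (meshDomain_subset_meshVertices _ _ hdart.2.1) _ (meshDomain_subset_meshVertices _ _ hdart.2.2)
      hdart.1 hye
  have hyQ : y ∈ range L₀ := by
    rw [hLr] at hyL
    rw [hL₀r]
    rcases hyL with h | h
    · rcases hΓp y h with h' | h'
      · exact Or.inl h'
      · exact absurd h'.1 havoid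
    · rcases hΓm y h with h' | h'
      · exact Or.inr h'
      · exact absurd h'.1 havoid
  obtain ⟨Q, hQ𝒞, hyQ'⟩ := mem_iUnion₂.1 (hL₀F hyQ)
  have hQ𝒬 : Q ∈ 𝒬 := Finset.mem_filter.2 ⟨hQ𝒞, y, hyQ', hyQ⟩
  obtain ⟨w, a, b, hw, hwc⟩ :=
    exists_corner_of_mem_segment_of_mem_closure_cell hδ0 (meshGraph_adj_iff.1 hdart.1).1 hye hyQ'
  refine ⟨Q, hQ𝒬, w, ?_, a, b, hwc⟩
  rcases hw with rfl | rfl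
  · exact W.dart_fst_mem_support_of_mem_darts he
  · exact W.dart_snd_mem_support_of_mem_darts he

end Summit.CriticalPhenomena.SAWScalingLimit.Theorems.IsingBoundaryRatio

end
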